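import Literature.NumberTheory.ConnesConsani2024.ProlateWaveCyclicPairsJacobiProofs
import Mathlib.Analysis.InnerProductSpace.l2Space
import HarnessLib

/-!
# Connes–Consani–Moscovici 2024, §2: bounded Jacobi operators as cyclic pairs, and Prop. 2.3 as printed is false

RH-FREE corpus literature (a textbook construction on `ℓ²(ℕ, ℂ)` and one counterexample; sequel
material with no leaf role; nothing here bears on the truth of RH).  WHAT THIS IS NOT: any claim
about RH.  Theorems only (no `def`, no named fact); companion of `ProlateWaveCyclicPairs.lean`
(statements, seat cc-t12) and `ProlateWaveCyclicPairsJacobiProofs.lean` (§2.1 proofs).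

## Contents

* `exists_jacobi_cyclicPair`: for bounded real sequences `a > 0`, `b` there is a cyclic pair
  `(D, ξ) = (J, δ_0)` on `ℓ²(ℕ, ℂ)` — `J` the bounded self-adjoint Jacobi (tridiagonal) operator
  `(Jξ)(m) = a(m−1)ξ(m−1) + b(m)ξ(m) + a(m)ξ(m+1)`, built from three weighted shifts (pattern of
  `Literature.MathematicalPhysics.QuantumManyBody.TruncatedFockSpace.weightedShift`), made a
  `LinearPMap` on `⊤` (self-adjoint by Mathlib's
  `ContinuousLinearMap.toPMap_adjoint_eq_adjoint_toPMap_of_dense`) — with `δ_0` cyclic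
  (`δ_{n+1} = a_n⁻¹ (J δ_n − b_n δ_n − a_{n−1} δ_{n−1})` puts every `δ_n` in the span of the
  iterates, which is then dense), Gram–Schmidt basis `ξ_n = δ_n`, Jacobi coefficients
  `jacobiCoeff = a` and diagonal `⟪ξ_n, D ξ_n⟫ = b_n` (identification by induction on the tree's
  general three-term recurrence `IsCyclicPair.map_cyclicBasisDom_succ`).
* `not_CCM2024_prop_2_3 : ¬ CCM2024_prop_2_3`: **Proposition 2.3 / eq. (11) AS PRINTED is false.**
  The named fact `CCM2024_prop_2_3` transcribes the print verbatim: with `φ(n) := Σ_{0≤j≤n} a_j⁻¹`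
  and `d(n,m) = |φ(n) − φ(m)|`, `½ d ≤ sup{|f(n) − f(m)| : ‖[D,f]‖ ≤ 1} ≤ d`.  For the Jacobi pair
  with `a_0 = 1`, `a_n = 2` (`n ≥ 1`), `b = 0`, the test sequence `f = δ_0` is admissible
  (`‖[D, δ_0]‖ ≤ a_0 = 1` by the block estimate `norm_sum_sameParity_le`) and has
  `|f(1) − f(0)| = 1 > ½ = a_1⁻¹ = d(1,0)`, contradicting the printed upper bound (if the
  admissible set were unbounded, Lean's `sSup = 0` contradicts the lower bound `¼ ≤ sSup` instead).
  The print carries an index slip — its own proof computes the supremum as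
  `Σ_{m≤j<n} a_j⁻¹ = φ(n−1) − φ(m−1)`; the corrected statement (`φ̃(n) = Σ_{0≤j<n} a_j⁻¹`) is the
  tree theorem `CCM2024_prop_2_3_corrected`.  (Eq. (9), by contrast, is NOT a print erratum: the
  tree's `CCM2024_eq_9` now carries the printed standing hypothesis "even cyclic pair" and is
  discharged by `CCM2024_eq_9_holds`.)

Source: A. Connes, C. Consani, H. Moscovici, *Zeta zeros and prolate wave operators*, Ann. Funct.
Anal. 15 (2024) 87 = arXiv:2310.18423, §2–§2.2 pp. 6–9 (Thm. 2.1, eq. (9), Prop. 2.2 eq. (10),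
Prop. 2.3 eq. (11), §2.2); held text `paper:arxiv-2310.18423`, locators `p0006:L3–L49`,
`p0007:L8–L62`. [bib: `ConnesConsaniMoscovici2024`]
-/

noncomputable section

open _root_.MeasureTheory Complex InnerProductSpace Submodule Set Function
open scoped InnerProductSpace ComplexConjugate ENNReal lp

namespace Literature.NumberTheory.ConnesConsani2024

/-! ### Weighted shifts on `ℓ²(ℕ, ℂ)` (pattern of `QuantumManyBody/TruncatedFockSpace.weightedShift`) -/

section L2

/-- `0 < (2 : ℝ≥0∞).toReal`. [folklore] -/
private theorem two_toReal_pos' : 0 < (2 : ℝ≥0∞).toReal := by norm_num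

/-- Square summability of the coordinates of an `ℓ²` sequence. [folklore] -/
private theorem l2_summable_norm_sq (x : ℓ²(ℕ, ℂ)) : Summable fun n => ‖x n‖ ^ 2 := by
  have h := lp.memℓp x
  rw [memℓp_gen_iff two_toReal_pos'] at h
  simpa [Real.rpow_two] using h

/-- `‖x‖² = Σ ‖x n‖²`. [folklore] -/
private theorem l2_norm_sq_eq_tsum (x : ℓ²(ℕ, ℂ)) : ‖x‖ ^ 2 = ∑' n, ‖x n‖ ^ 2 := by
  have h := lp.norm_rpow_eq_tsum two_toReal_pos' x
  simpa [Real.rpow_two] using h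

/-- `Σ_d |w(d) ξ(σ d)|² ≤ C² ‖ξ‖²` for a weight `|w| ≤ C` and `σ` injective on the support of `w`.
[folklore] -/
private theorem l2_tsum_sq_weighted_le (w : ℕ → ℂ) (σ : ℕ → ℕ) (hσ : InjOn σ {d | w d ≠ 0})
    {C : ℝ} (hw : ∀ d, ‖w d‖ ≤ C) (ξ : ℓ²(ℕ, ℂ)) :
    Summable (fun d => ‖w d * ξ (σ d)‖ ^ 2) ∧ ∑' d, ‖w d * ξ (σ d)‖ ^ 2 ≤ C ^ 2 * ‖ξ‖ ^ 2 := by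
  classical
  set S : Set ℕ := {d | w d ≠ 0} with hS
  have hξ := l2_summable_norm_sq ξ
  have hinj : Injective (fun d : S => σ d) := fun a b h => Subtype.ext (hσ a.2 b.2 h)
  have h1 : Summable fun d : S => ‖ξ (σ d)‖ ^ 2 := hξ.comp_injective hinj
  have hle1 : ∑' d : S, ‖ξ (σ d)‖ ^ 2 ≤ ∑' d, ‖ξ d‖ ^ 2 :=
    tsum_comp_le_tsum_of_inj hξ (fun _ => by positivity) hinj
  have hvan : ∀ d, d ∉ S → ‖w d * ξ (σ d)‖ ^ 2 = 0 := fun d hd => by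
    simp only [hS, mem_setOf_eq, not_not] at hd
    simp [hd]
  have hbound : ∀ d : S, ‖w d * ξ (σ d)‖ ^ 2 ≤ C ^ 2 * ‖ξ (σ d)‖ ^ 2 := fun d => by
    rw [norm_mul, mul_pow]
    exact mul_le_mul_of_nonneg_right (pow_le_pow_left₀ (norm_nonneg _) (hw d) 2) (by positivity)
  have h2 : Summable fun d : S => ‖w d * ξ (σ d)‖ ^ 2 :=
    (h1.mul_left (C ^ 2)).of_nonneg_of_le (fun _ => by positivity) hbound
  have hind : S.indicator (fun d => ‖w d * ξ (σ d)‖ ^ 2) = fun d => ‖w d * ξ (σ d)‖ ^ 2 := by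
    funext d
    by_cases hd : d ∈ S
    · rw [indicator_of_mem hd]
    · rw [indicator_of_notMem hd, hvan d hd]
  have h3 : Summable fun d => ‖w d * ξ (σ d)‖ ^ 2 := by
    rw [← hind]; exact summable_subtype_iff_indicator.1 h2
  refine ⟨h3, ?_⟩
  calc ∑' d, ‖w d * ξ (σ d)‖ ^ 2 = ∑' d, S.indicator (fun d => ‖w d * ξ (σ d)‖ ^ 2) d := by
        rw [hind]
    _ = ∑' d : S, ‖w d * ξ (σ d)‖ ^ 2 := (tsum_subtype S _).symm
    _ ≤ ∑' d : S, C ^ 2 * ‖ξ (σ d)‖ ^ 2 := h2.tsum_le_tsum hbound (h1.mul_left _)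
    _ = C ^ 2 * ∑' d : S, ‖ξ (σ d)‖ ^ 2 := tsum_mul_left
    _ ≤ C ^ 2 * ∑' d, ‖ξ d‖ ^ 2 := by gcongr
    _ = C ^ 2 * ‖ξ‖ ^ 2 := by rw [l2_norm_sq_eq_tsum]

/-- The weighted shift of an `ℓ²` sequence is `ℓ²`. [folklore] -/
private theorem l2_memℓp_weighted (w : ℕ → ℂ) (σ : ℕ → ℕ) (hσ : InjOn σ {d | w d ≠ 0}) {C : ℝ}
    (hw : ∀ d, ‖w d‖ ≤ C) (ξ : ℓ²(ℕ, ℂ)) : Memℓp (fun d => w d * ξ (σ d)) 2 := by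
  rw [memℓp_gen_iff two_toReal_pos']
  simpa [Real.rpow_two] using (l2_tsum_sq_weighted_le w σ hσ hw ξ).1

/-- **Weighted shifts are bounded operators on `ℓ²(ℕ, ℂ)`**: `(T ξ)(d) = w(d) ξ(σ d)` for a
bounded weight `w` and a relabelling `σ` injective on the support of `w`. [folklore] -/
private theorem exists_weightedShift (w : ℕ → ℂ) (σ : ℕ → ℕ) (hσ : InjOn σ {d | w d ≠ 0})
    {C : ℝ} (hC : 0 ≤ C) (hw : ∀ d, ‖w d‖ ≤ C) :
    ∃ T : ℓ²(ℕ, ℂ) →L[ℂ] ℓ²(ℕ, ℂ), ∀ (ξ : ℓ²(ℕ, ℂ)) (d : ℕ), T ξ d = w d * ξ (σ d) := by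
  let Tl : ℓ²(ℕ, ℂ) →ₗ[ℂ] ℓ²(ℕ, ℂ) :=
    { toFun := fun ξ => ⟨fun d => w d * ξ (σ d), l2_memℓp_weighted w σ hσ hw ξ⟩
      map_add' := fun ξ η => by
        ext d
        show w d * (ξ + η) (σ d) = w d * ξ (σ d) + w d * η (σ d)
        rw [lp.coeFn_add, Pi.add_apply, mul_add]
      map_smul' := fun c ξ => by
        ext d
        simp only [lp.coeFn_smul, Pi.smul_apply, smul_eq_mul, RingHom.id_apply]
        show w d * (c * ξ (σ d)) = c * (w d * ξ (σ d))
        ring }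
  refine ⟨Tl.mkContinuous C fun ξ => ?_, fun ξ d => rfl⟩
  refine lp.norm_le_of_tsum_le two_toReal_pos' (by positivity) ?_
  have h := (l2_tsum_sq_weighted_le w σ hσ hw ξ).2
  simp only [ENNReal.toReal_ofNat, Real.rpow_two, mul_pow]
  exact h

/-- `⟪u, v⟫ = Σ conj(u n) v n` on `ℓ²(ℕ, ℂ)`. [folklore] -/
private theorem l2_inner_eq_tsum (u v : ℓ²(ℕ, ℂ)) : ⟪u, v⟫_ℂ = ∑' n, conj (u n) * v n := by
  rw [lp.inner_eq_tsum]
  simp_rw [RCLike.inner_apply']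

/-- The coordinate products of two `ℓ²` sequences are summable. [folklore] -/
private theorem l2_summable_conj_mul (u v : ℓ²(ℕ, ℂ)) : Summable fun n => conj (u n) * v n := by
  have h := lp.summable_inner (𝕜 := ℂ) u v
  simp_rw [RCLike.inner_apply'] at h
  exact h

/-- **Bounded Jacobi operators.** For bounded real sequences `a` (off-diagonal) and `b` (diagonal)
there is a bounded self-adjoint operator `J` on `ℓ²(ℕ, ℂ)` with
`(J ξ)(m) = a(m−1) ξ(m−1) + b(m) ξ(m) + a(m) ξ(m+1)` (`ξ(−1) := 0`). [folklore] -/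
private theorem exists_jacobiOp (a b : ℕ → ℝ) {C : ℝ} (hC : 0 ≤ C) (ha : ∀ n, |a n| ≤ C)
    (hb : ∀ n, |b n| ≤ C) :
    ∃ J : ℓ²(ℕ, ℂ) →L[ℂ] ℓ²(ℕ, ℂ), IsSelfAdjoint J ∧
      ∀ (ξ : ℓ²(ℕ, ℂ)) (m : ℕ), J ξ m =
        (if m = 0 then 0 else (a (m - 1) : ℂ) * ξ (m - 1)) + (b m : ℂ) * ξ m +
          (a m : ℂ) * ξ (m + 1) := by
  -- the three weighted shifts
  have hw1 : ∀ d : ℕ, ‖(if d = 0 then (0 : ℂ) else (a (d - 1) : ℂ))‖ ≤ C := by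
    intro d
    split_ifs
    · simpa using hC
    · rw [Complex.norm_real, Real.norm_eq_abs]; exact ha _
  have hσ1 : InjOn (fun d : ℕ => d - 1) {d | (if d = 0 then (0 : ℂ) else (a (d - 1) : ℂ)) ≠ 0} := by
    intro d hd d' hd' h
    have h0 : d ≠ 0 := fun h0 => by simp [h0] at hd
    have h0' : d' ≠ 0 := fun h0' => by simp [h0'] at hd'
    simp only at h
    omega
  have hw2 : ∀ d : ℕ, ‖(b d : ℂ)‖ ≤ C := fun d => by
    rw [Complex.norm_real, Real.norm_eq_abs]; exact hb _
  have hw3 : ∀ d : ℕ, ‖(a d : ℂ)‖ ≤ C := fun d => by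
    rw [Complex.norm_real, Real.norm_eq_abs]; exact ha _
  obtain ⟨T₁, hT₁⟩ := exists_weightedShift (fun d => if d = 0 then (0 : ℂ) else (a (d - 1) : ℂ))
    (fun d => d - 1) hσ1 hC hw1
  obtain ⟨T₂, hT₂⟩ := exists_weightedShift (fun d => (b d : ℂ)) id (injOn_id _) hC hw2
  obtain ⟨T₃, hT₃⟩ := exists_weightedShift (fun d => (a d : ℂ)) (fun d => d + 1)
    (fun d _ d' _ h => by simpa using h) hC hw3
  refine ⟨T₁ + T₂ + T₃, ?_, fun ξ m => ?_⟩
  · -- symmetry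
    have h2 : ∀ x y : ℓ²(ℕ, ℂ), ⟪T₂ x, y⟫_ℂ = ⟪x, T₂ y⟫_ℂ := by
      intro x y
      rw [l2_inner_eq_tsum, l2_inner_eq_tsum]
      refine tsum_congr fun n => ?_
      rw [hT₂, hT₂, map_mul, Complex.conj_ofReal]
      simp only [id]
      ring
    have h31 : ∀ x y : ℓ²(ℕ, ℂ), ⟪T₃ x, y⟫_ℂ = ⟪x, T₁ y⟫_ℂ := by
      intro x y
      rw [l2_inner_eq_tsum, l2_inner_eq_tsum, (l2_summable_conj_mul x (T₁ y)).tsum_eq_zero_add]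
      have h0 : conj (x 0) * T₁ y 0 = 0 := by rw [hT₁]; simp
      rw [h0, zero_add]
      refine tsum_congr fun n => ?_
      rw [hT₃, hT₁, map_mul, Complex.conj_ofReal]
      simp only [Nat.succ_ne_zero, if_false, Nat.add_sub_cancel]
      ring
    have h13 : ∀ x y : ℓ²(ℕ, ℂ), ⟪T₁ x, y⟫_ℂ = ⟪x, T₃ y⟫_ℂ := by
      intro x y
      rw [← inner_conj_symm, ← h31, inner_conj_symm]
    have hsym : (↑(T₁ + T₂ + T₃) : ℓ²(ℕ, ℂ) →ₗ[ℂ] ℓ²(ℕ, ℂ)).IsSymmetric := by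
      intro x y
      simp only [ContinuousLinearMap.coe_coe, add_apply, inner_add_left,
        inner_add_right]
      rw [h13, h2, h31]
      ring
    exact ContinuousLinearMap.isSelfAdjoint_iff_isSymmetric.mpr hsym
  · simp only [add_apply, lp.coeFn_add, Pi.add_apply, hT₁, hT₂, hT₃, id]
    split_ifs <;> simp

end L2

/-! ### The Jacobi cyclic pair `(J, δ_0)` on `ℓ²(ℕ, ℂ)` -/

section JacobiPair

/-- Coordinates of the standard basis vector `δ_n`. [folklore] -/
private theorem single_apply' (n m : ℕ) :
    (lp.single 2 n (1 : ℂ) : ℓ²(ℕ, ℂ)) m = if m = n then 1 else 0 := by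
  rw [lp.single_apply, Pi.single_apply]

/-- `⟪δ_n, x⟫ = x n`. [folklore] -/
private theorem inner_single_left' (n : ℕ) (x : ℓ²(ℕ, ℂ)) :
    ⟪(lp.single 2 n (1 : ℂ) : ℓ²(ℕ, ℂ)), x⟫_ℂ = x n := by
  rw [lp.inner_single_left]; simp

/-- The standard basis of `ℓ²(ℕ, ℂ)` is orthonormal. [folklore] -/
private theorem orthonormal_single :
    Orthonormal ℂ (fun n : ℕ => (lp.single 2 n (1 : ℂ) : ℓ²(ℕ, ℂ))) := by
  classical
  rw [orthonormal_iff_ite]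
  intro i j
  rw [inner_single_left', single_apply']

/-- The default Hilbert basis of `ℓ²(ℕ, ℂ)` is the standard basis. [folklore] -/
private theorem hilbertBasis_default_apply (n : ℕ) :
    (default : HilbertBasis ℕ ℂ ℓ²(ℕ, ℂ)) n = lp.single 2 n (1 : ℂ) := by
  rw [← HilbertBasis.repr_symm_single]
  rfl

/-- The standard basis has dense span. [folklore] -/
private theorem topologicalClosure_span_single :
    (span ℂ (Set.range fun n : ℕ => (lp.single 2 n (1 : ℂ) : ℓ²(ℕ, ℂ)))).topologicalClosure = ⊤ := by
  have h := (default : HilbertBasis ℕ ℂ ℓ²(ℕ, ℂ)).dense_span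
  have hcoe : ((default : HilbertBasis ℕ ℂ ℓ²(ℕ, ℂ)) : ℕ → ℓ²(ℕ, ℂ)) =
      fun n => lp.single 2 n (1 : ℂ) := funext hilbertBasis_default_apply
  rwa [hcoe] at h

/-- `c' • u = c • w` with `c', c > 0` and unit vectors `u, w` forces `c' = c` and `u = w`. [folklore] -/
private theorem smul_unit_eq_smul_unit {c' : ℂ} {c : ℝ} {u w : ℓ²(ℕ, ℂ)}
    (hre : ((c'.re : ℝ) : ℂ) = c') (hpos : 0 < c'.re) (hc : 0 < c) (hu : ‖u‖ = 1) (hw : ‖w‖ = 1)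
    (h : c' • u = (c : ℂ) • w) : c' = c ∧ u = w := by
  have hn := congrArg (fun z : ℓ²(ℕ, ℂ) => ‖z‖) h
  simp only [norm_smul, hu, hw, mul_one, Complex.norm_real, Real.norm_eq_abs, abs_of_pos hc] at hn
  have hc' : c' = (c : ℂ) := by
    rw [← hre] at hn ⊢
    rw [Complex.norm_real, Real.norm_eq_abs, abs_of_pos hpos] at hn
    rw [hn]
  refine ⟨hc', ?_⟩
  rw [hc'] at h
  have hne : (c : ℂ) ≠ 0 := by exact_mod_cast hc.ne'
  exact smul_right_injective _ hne h

/-- Coordinates of `J δ_0` (bookkeeping of Kronecker deltas). [folklore] -/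
private theorem jacobi_coords_single_zero (a b : ℕ → ℝ) (m : ℕ) :
    ((if m = 0 then 0 else (a (m - 1) : ℂ) * (if m - 1 = 0 then 1 else 0)) +
        (b m : ℂ) * (if m = 0 then 1 else 0) + (a m : ℂ) * (if m + 1 = 0 then 1 else 0)) =
      (b 0 : ℂ) * (if m = 0 then 1 else 0) + (a 0 : ℂ) * (if m = 1 then 1 else 0) := by
  rcases m with _ | m
  · simp
  · by_cases hm : m = 0
    · subst hm; simp
    · simp [hm]

/-- Coordinates of `J δ_{n+1}` (bookkeeping of Kronecker deltas). [folklore] -/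
private theorem jacobi_coords_single_succ (a b : ℕ → ℝ) (n m : ℕ) :
    ((if m = 0 then 0 else (a (m - 1) : ℂ) * (if m - 1 = n + 1 then 1 else 0)) +
        (b m : ℂ) * (if m = n + 1 then 1 else 0) +
        (a m : ℂ) * (if m + 1 = n + 1 then 1 else 0)) =
      (a n : ℂ) * (if m = n then 1 else 0) + (b (n + 1) : ℂ) * (if m = n + 1 then 1 else 0) +
        (a (n + 1) : ℂ) * (if m = n + 2 then 1 else 0) := by
  rcases m with _ | m
  · rcases n with _ | k
    · simp
    · simp
  · by_cases h1 : m = n + 1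
    · subst h1
      have h2 : n + 1 + 1 ≠ n := by omega
      simp [h2]
    · by_cases h2 : m = n
      · subst h2
        simp
      · by_cases h3 : m + 1 = n
        · subst h3
          have h4 : m ≠ m + 1 + 1 := by omega
          simp [h4]
        · simp [h1, h2, h3]

/-- RH-FREE. **The Jacobi cyclic pair.** For bounded real sequences `a > 0` and `b`, the bounded
self-adjoint Jacobi operator `J` on `ℓ²(ℕ, ℂ)` (`(Jξ)(m) = a(m−1)ξ(m−1) + b(m)ξ(m) + a(m)ξ(m+1)`)
together with the cyclic vector `δ_0` is a cyclic pair in the sense of CCM §2 (as the everywhere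
defined `LinearPMap`), whose Gram–Schmidt basis is the standard basis `ξ_n = δ_n`, with Jacobi
coefficients `a_n = ⟨J δ_n | δ_{n+1}⟩` and diagonal `b_n = ⟨δ_n | J δ_n⟩`.  This is the bounded
case of the converse direction of §2.2 ("an even cyclic pair is determined by the sequence `(a_n)`
which gives the Jacobi matrix of the operator `D` in the basis `(ξ_n)`"), where no self-adjointness
issue arises; it supplies the test pairs for `not_CCM2024_prop_2_3`.
[cite: ConnesConsaniMoscovici2024, §2.2 p. 9 (p0007:L62); Thm. 2.1 p. 6 (p0006:L7)] -/
theorem exists_jacobi_cyclicPair (a b : ℕ → ℝ) {C : ℝ} (hC : 0 ≤ C) (ha : ∀ n, |a n| ≤ C)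
    (hb : ∀ n, |b n| ≤ C) (hpos : ∀ n, 0 < a n) :
    ∃ (D : ℓ²(ℕ, ℂ) →ₗ.[ℂ] ℓ²(ℕ, ℂ)) (ξ : ℓ²(ℕ, ℂ)) (v : ℕ → D.domain),
      IsCyclicPair D ξ ∧ IsIterateSeq D ξ v ∧
      (∀ n, cyclicBasis v n = lp.single 2 n (1 : ℂ)) ∧
      (∀ n, jacobiCoeff v n = a n) ∧
      (∀ n, ⟪cyclicBasis v n, (D (cyclicBasisDom v n) : ℓ²(ℕ, ℂ))⟫_ℂ = b n) := by
  classical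
  obtain ⟨J, hJsa, hJ⟩ := exists_jacobiOp a b hC ha hb
  set e : ℕ → ℓ²(ℕ, ℂ) := fun n => lp.single 2 n (1 : ℂ) with he
  have he_on : Orthonormal ℂ e := orthonormal_single
  have hite := orthonormal_iff_ite.mp he_on
  have hane : ∀ n, (a n : ℂ) ≠ 0 := fun n => by exact_mod_cast (hpos n).ne'
  -- closed form of `J` on basis vectors
  have hJe0 : J (e 0) = (b 0 : ℂ) • e 0 + (a 0 : ℂ) • e 1 := by
    apply lp.ext; funext m
    simp only [lp.coeFn_add, Pi.add_apply, lp.coeFn_smul, Pi.smul_apply, smul_eq_mul, hJ, he,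
      single_apply']
    exact jacobi_coords_single_zero a b m
  have hJesucc : ∀ n, J (e (n + 1)) =
      (a n : ℂ) • e n + (b (n + 1) : ℂ) • e (n + 1) + (a (n + 1) : ℂ) • e (n + 2) := by
    intro n
    apply lp.ext; funext m
    simp only [lp.coeFn_add, Pi.add_apply, lp.coeFn_smul, Pi.smul_apply, smul_eq_mul, hJ, he,
      single_apply']
    exact jacobi_coords_single_succ a b n m
  -- diagonal matrix coefficients
  have hdiag0 : ⟪e 0, J (e 0)⟫_ℂ = b 0 := by
    rw [hJe0, inner_add_right, inner_smul_right, inner_smul_right, hite, hite]; simp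
  have hdiagsucc : ∀ n, ⟪e (n + 1), J (e (n + 1))⟫_ℂ = b (n + 1) := by
    intro n
    rw [hJesucc, inner_add_right, inner_add_right, inner_smul_right, inner_smul_right,
      inner_smul_right, hite, hite, hite]
    simp
  -- the cyclic pair data
  set D : ℓ²(ℕ, ℂ) →ₗ.[ℂ] ℓ²(ℕ, ℂ) := (J : ℓ²(ℕ, ℂ) →ₗ[ℂ] ℓ²(ℕ, ℂ)).toPMap ⊤ with hDdef
  have hDapply : ∀ x : D.domain, (D x : ℓ²(ℕ, ℂ)) = J (x : ℓ²(ℕ, ℂ)) := fun x =>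
    LinearMap.toPMap_apply _ _ _
  set v : ℕ → D.domain := fun j => ⟨(fun x => J x)^[j] (e 0), Submodule.mem_top⟩ with hvdef
  have hv : IsIterateSeq D (e 0) v := by
    refine ⟨by simp [hvdef], fun j => ?_⟩
    rw [hDapply]
    simp only [hvdef, Function.iterate_succ_apply']
  -- cyclicity: every `δ_n` lies in the span `W` of the iterates
  set W : Submodule ℂ ℓ²(ℕ, ℂ) := span ℂ (Set.range fun j => (v j : ℓ²(ℕ, ℂ))) with hW
  have hWJ : ∀ x ∈ W, J x ∈ W := by
    intro x hx
    induction hx using Submodule.span_induction with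
    | mem y hy =>
      obtain ⟨j, rfl⟩ := hy
      refine subset_span ⟨j + 1, ?_⟩
      simp only [hvdef, Function.iterate_succ_apply']
    | zero => rw [map_zero]; exact zero_mem _
    | add y z _ _ hy hz => rw [map_add]; exact add_mem hy hz
    | smul c y _ hy => rw [map_smul]; exact smul_mem _ _ hy
  have he_mem : ∀ n, e n ∈ W ∧ e (n + 1) ∈ W := by
    intro n
    induction n with
    | zero =>
      have h0 : e 0 ∈ W := subset_span ⟨0, by simp [hvdef]⟩
      refine ⟨h0, ?_⟩
      have h1 : e 1 = ((a 0 : ℂ))⁻¹ • (J (e 0) - (b 0 : ℂ) • e 0) := by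
        rw [hJe0, add_sub_cancel_left, smul_smul, inv_mul_cancel₀ (hane 0), one_smul]
      rw [h1]
      exact smul_mem _ _ (sub_mem (hWJ _ h0) (smul_mem _ _ h0))
    | succ n ih =>
      refine ⟨ih.2, ?_⟩
      have h1 : e (n + 1 + 1) = ((a (n + 1) : ℂ))⁻¹ •
          (J (e (n + 1)) - (a n : ℂ) • e n - (b (n + 1) : ℂ) • e (n + 1)) := by
        have h3 : J (e (n + 1)) - (a n : ℂ) • e n - (b (n + 1) : ℂ) • e (n + 1) =
            (a (n + 1) : ℂ) • e (n + 2) := by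
          rw [hJesucc n]; module
        rw [h3, smul_smul, inv_mul_cancel₀ (hane (n + 1)), one_smul]
      rw [h1]
      exact smul_mem _ _ (sub_mem (sub_mem (hWJ _ ih.2) (smul_mem _ _ ih.1)) (smul_mem _ _ ih.2))
  have hdense : Dense (W : Set ℓ²(ℕ, ℂ)) := by
    rw [Submodule.dense_iff_topologicalClosure_eq_top]
    have h1 : span ℂ (Set.range e) ≤ W :=
      span_le.mpr (by rintro _ ⟨n, rfl⟩; exact (he_mem n).1)
    have h2 := Submodule.topologicalClosure_mono h1
    rw [he, topologicalClosure_span_single] at h2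
    exact top_le_iff.mp h2
  have hD : IsCyclicPair D (e 0) :=
    { isSelfAdjoint := by
        rw [LinearPMap.isSelfAdjoint_def, hDdef,
          ContinuousLinearMap.toPMap_adjoint_eq_adjoint_toPMap_of_dense J
            (by rw [Submodule.top_coe]; exact dense_univ),
          ContinuousLinearMap.isSelfAdjoint_iff'.mp hJsa]
      norm_eq_one := he_on.1 0
      not_finiteDimensional := fun hfin => by
        haveI := hfin
        haveI : Finite ℕ := he_on.linearIndependent.finite
        exact not_finite ℕ
      exists_iterateSeq_dense := ⟨v, hv, hdense⟩ }
  -- identification of the Gram–Schmidt basis with the standard basis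
  have hDcb : ∀ n, (D (cyclicBasisDom v n) : ℓ²(ℕ, ℂ)) = J (cyclicBasis v n) := fun n => hDapply _
  have hξ0 : cyclicBasis v 0 = e 0 := by
    have hg : gramSchmidt ℂ (fun j => (v j : ℓ²(ℕ, ℂ))) 0 = e 0 := by
      rw [gramSchmidt_def]; simp [hvdef]
    show gramSchmidtNormed ℂ (fun j => (v j : ℓ²(ℕ, ℂ))) 0 = e 0
    rw [gramSchmidtNormed, hg, he_on.1 0]; simp
  have hstep : ∀ n, cyclicBasis v n = e n ∧ cyclicBasis v (n + 1) = e (n + 1) ∧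
      jacobiCoeff v n = a n := by
    intro n
    induction n with
    | zero =>
      have hrec := hD.map_cyclicBasisDom_zero hv
      rw [hDcb 0, hξ0, hdiag0, hJe0] at hrec
      have h2 : jacobiCoeff v 0 • cyclicBasis v 1 = (a 0 : ℂ) • e 1 := (add_left_cancel hrec).symm
      obtain ⟨hj, hξ1⟩ := smul_unit_eq_smul_unit (hD.jacobiCoeff_re_pos hv 0).1
        (hD.jacobiCoeff_re_pos hv 0).2 (hpos 0) (hD.norm_cyclicBasis hv 1) (he_on.1 1) h2
      exact ⟨hξ0, hξ1, hj⟩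
    | succ n ih =>
      obtain ⟨hn, hn1, hjn⟩ := ih
      have hrec := hD.map_cyclicBasisDom_succ hv n
      rw [hDcb (n + 1), hn1, hn, hjn, hdiagsucc n, hJesucc n] at hrec
      have h2 : jacobiCoeff v (n + 1) • cyclicBasis v (n + 2) = (a (n + 1) : ℂ) • e (n + 2) :=
        (add_left_cancel hrec).symm
      obtain ⟨hj, hξ2⟩ := smul_unit_eq_smul_unit (hD.jacobiCoeff_re_pos hv (n + 1)).1
        (hD.jacobiCoeff_re_pos hv (n + 1)).2 (hpos (n + 1)) (hD.norm_cyclicBasis hv (n + 2))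
        (he_on.1 (n + 2)) h2
      exact ⟨hn1, hξ2, hj⟩
  refine ⟨D, e 0, v, hD, hv, fun n => (hstep n).1, fun n => (hstep n).2.2, fun n => ?_⟩
  rw [hDcb n, (hstep n).1]
  cases n with
  | zero => exact hdiag0
  | succ n => exact hdiagsucc n

end JacobiPair

/-! ### The refutation of Prop. 2.3 as printed -/

section Refutations

/-- RH-FREE. **The named fact `CCM2024_prop_2_3` (Prop. 2.3 / eq. (11) AS PRINTED) is false.**  For
the bounded Jacobi cyclic pair on `ℓ²(ℕ, ℂ)` with `a_0 = 1`, `a_n = 2` (`n ≥ 1`), `b = 0`, the test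
sequence `f = δ_0 ∈ c_c(ℕ)` has `‖[D, f]‖ ≤ a_0 = 1` and `|f(1) − f(0)| = 1`, while the printed upper
bound is `d(1,0) = φ(1) − φ(0) = a_1⁻¹ = ½` (`φ(n) = Σ_{0≤j≤n} a_j⁻¹` as printed): `1 ≤ ½` (or, were
the admissible set unbounded, `¼ ≤ sSup = 0`).  The printed statement carries an index slip; the
corrected statement (`φ̃(n) = Σ_{0≤j<n} a_j⁻¹`) is the tree theorem `CCM2024_prop_2_3_corrected`,
which is what the printed proof proves. [cite: ConnesConsaniMoscovici2024, Prop. 2.3 eq. (11) p. 8 (p0007:L52–L60)] -/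
theorem not_CCM2024_prop_2_3 : ¬ CCM2024_prop_2_3 := by
  classical
  intro h
  obtain ⟨D, ξ, v, hD, hv, -, hjac, -⟩ := exists_jacobi_cyclicPair
    (fun n => if n = 0 then 1 else 2) (fun _ => 0) (C := 2) zero_le_two
    (fun n => by split_ifs <;> norm_num) (fun _ => by simp) (fun n => by split_ifs <;> norm_num)
  have h10 := h D ξ v hD hv 1 0
  set a' := jacobiCoeff v with ha'
  set S : Set ℝ := {r | ∃ f : ℕ →₀ ℂ, ‖commutatorOp (cyclicBasis v) a' f‖ ≤ 1 ∧ r = ‖f 1 - f 0‖}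
    with hS
  have ha0 : a' 0 = 1 := by rw [hjac 0]; simp
  have ha1 : a' 1 = 2 := by rw [hjac 1]; simp
  -- the printed `d(1,0) = |φ(1) − φ(0)| = a_1⁻¹ = 1/2`
  have hd : |spectralPhi a' 1 - spectralPhi a' 0| = 1 / 2 := by
    simp only [spectralPhi, Finset.sum_range_succ, Finset.sum_range_zero, ha0, ha1]
    norm_num
  obtain ⟨hlow, hup⟩ := h10
  change |spectralPhi a' 1 - spectralPhi a' 0| / 2 ≤ sSup S at hlow
  change sSup S ≤ |spectralPhi a' 1 - spectralPhi a' 0| at hup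
  rw [hd] at hlow hup
  -- the test sequence `f = δ_0` is admissible with `|f(1) − f(0)| = 1`
  have hmem : (1 : ℝ) ∈ S := by
    refine ⟨Finsupp.single 0 1, ?_, by simp⟩
    have hsup : (Finsupp.single 0 (1 : ℂ)).support.sup id = 0 := by
      refine le_antisymm (Finset.sup_le fun i hi => ?_) (Nat.zero_le _)
      have := Finsupp.support_single_subset hi
      rw [Finset.mem_singleton] at this
      simp [this]
    refine ContinuousLinearMap.opNorm_le_bound _ zero_le_one fun x => ?_
    rw [commutatorOp_apply, hsup]
    refine norm_sum_sameParity_le (hD.orthonormal_cyclicBasis hv) _ x _ 0 (fun i hi => ?_)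
      zero_le_one (fun i hi => ?_)
    · have : i = 0 := by simpa using hi
      simp [this]
    · have : i = 0 := by simpa using hi
      subst this
      simp [ha0]
  by_cases hbdd : BddAbove S
  · have := le_csSup hbdd hmem
    linarith
  · rw [Real.sSup_of_not_bddAbove hbdd] at hlow
    linarith

end Refutations

end Literature.NumberTheory.ConnesConsani2024
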